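import Mathlib

/-!
# Negative knowledge for crux `JParityClosure.OddContactSymmetry` (stmt-AtomisticToContinuum-13078):
# the parity-exact weight family — what a bounded repair of the reweighting may and may not be

Standing disprover `refuter-cdisprove-stmt-AtomisticToContinuum-13078-g2-0` (gen 2, 2026-08-16), companion of
`Cruxes/OddContactSymmetry/Disproof.lean` §8.  Context: the crux AS FILED weights every ordered contact pair by the
UNTRUNCATED factor `1 + e^{−F}`, `e^{−F} = b′/b` (`b = h(v⁻)h(w⁻)`, `b′ = h(v⁺)h(w⁺)`, `h` the `(r,ϑ)`-mollified empirical
law), which is not tight (velocity-hole blow-up, `VelocityHoleWeight.lean`, `TailBlowupAndCutoff.lean`); every seat asks the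
planner to re-file with a BOUNDED weight `m(e^{−F})`.  Dictionary (Disproof §2): at a collision parameter `q` with incoming
pair density `a` and at its inverse collision `J q` with density `a′`, the weights are `m(b′/b)` and `m(b/b′)`, and the
`J`-odd residual tested by the crux is `a·m(b′/b) − a′·m(b/b′)`.  Call `m` PARITY-EXACT when this residual vanishes at exact
twisted balance `a b′ = a′ b` — the property that makes the limit content of the re-filed crux IDENTICAL to the filed one
(`γ̄_a = 0`, neither more nor less).  This file settles, by elementary algebra, which weights qualify:

* `parityExact_iff` — `m` is parity-exact iff `m R = R · m R⁻¹` on `R > 0` (functional equation), iff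
  `t ↦ e^{−t/2} m(e^t)` is even (`parityExact_iff_even`); then the residual FACTORS as `m(b′/b)·(ab′ − a′b)/b′`
  (`parityExact_residual`), so it vanishes iff twisted balance whenever `m > 0` (`parityExact_residual_eq_zero_iff`).
* members: `1 + R` (the filed weight, unbounded), `min 1 R` (Metropolis, card metropolis-min-weight, C′₃),
  `R/(1+R)` (Barker / Fermi, smooth), and `m·ζ` for any parity-exact `m` and any inversion-symmetric factor
  `ζ R = ζ R⁻¹` (the even-cutoff family C″ of Disproof §7) — `parityExact_one_add`, `parityExact_min`,
  `parityExact_barker`, `parityExact_mul_symm`; closed residuals `metropolis_residual`, `barker_residual`.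
* NON-members: the plain truncation `min (1+R) L` (`not_parityExact_trunc`, cf. `truncation_breaks_parity`,
  `TruncationResidual.lean`).
* `le_min_of_parityExact_le_one` — **Metropolis is maximal**: every parity-exact weight with `m ≤ 1` satisfies
  `m R ≤ min 1 R`.  So among sub-unit parity-exact repairs `min 1 (e^{−F})` discards the least statistics; but it is NOT
  unique (`not_unique_subunit_parityExact`: Barker is another) — the uniqueness claim in the title of card
  metropolis-min-weight is false as stated; "maximal" is the correct word.  Any sub-unit member gives
  `|D_N| ≤ ‖χ g Ψ‖_∞ · K_N[1]` pathwise, i.e. tightness = collision-count tightness (CollisionCountRung0 at rung 0).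
-/

namespace Summit.AtomisticToContinuum.HydrodynamicLimit.Theorems

namespace OddContactSymmetryNegative

/-! ## The functional equation and the factorised residual -/

/-- For a weight satisfying the functional equation `m R = R · m R⁻¹` (`R > 0`), the `J`-odd residual of the reweighted
contact pair factors through the twisted-balance defect: `a·m(b′/b) − a′·m(b/b′) = m(b′/b)·(a b′ − a′ b)/b′`. [folklore] -/
theorem parityExact_residual (m : ℝ → ℝ) (hm : ∀ R : ℝ, 0 < R → m R = R * m R⁻¹)
    (a a' : ℝ) {b b' : ℝ} (hb : 0 < b) (hb' : 0 < b') :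
    a * m (b' / b) - a' * m (b / b') = m (b' / b) * (a * b' - a' * b) / b' := by
  have hR : 0 < b' / b := div_pos hb' hb
  have hinv : b / b' = (b' / b)⁻¹ := by rw [inv_div]
  have h2 : m (b / b') = (b / b') * m (b' / b) := by
    rw [hinv, hm (b' / b) hR, ← mul_assoc, inv_mul_cancel₀ hR.ne', one_mul]
  rw [h2]
  field_simp

/-- **Characterisation.**  `m` satisfies the functional equation `m R = R · m R⁻¹` on `R > 0` iff it is PARITY-EXACT: the
`J`-odd residual `a·m(b′/b) − a′·m(b/b′)` vanishes at every exactly twisted-balanced datum `a b′ = a′ b` (`b, b′ > 0`).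
[folklore] -/
theorem parityExact_iff (m : ℝ → ℝ) :
    (∀ R : ℝ, 0 < R → m R = R * m R⁻¹) ↔
      ∀ a a' b b' : ℝ, 0 < b → 0 < b' → a * b' = a' * b → a * m (b' / b) = a' * m (b / b') := by
  constructor
  · intro hm a a' b b' hb hb' hbal
    have h := parityExact_residual m hm a a' hb hb'
    rw [hbal, sub_self, mul_zero, zero_div, sub_eq_zero] at h
    exact h
  · intro H R hR
    have h := H 1 R 1 R one_pos hR (by ring)
    rw [div_one, one_mul, one_div] at h
    exact h

/-- **Evenness form.**  The functional equation says exactly that `t ↦ e^{−t/2} m(e^t)` is an even function, i.e.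
`m R = √R · k(log R)` with `k` even: parity-exact weights are the even functions of the surprisal jump `F = −log R` dressed
by `e^{−F/2}`. [folklore] -/
theorem parityExact_iff_even (m : ℝ → ℝ) :
    (∀ R : ℝ, 0 < R → m R = R * m R⁻¹) ↔
      ∀ t : ℝ, Real.exp (-t / 2) * m (Real.exp t) = Real.exp (t / 2) * m (Real.exp (-t)) := by
  constructor
  · intro hm t
    rw [hm (Real.exp t) (Real.exp_pos t), ← Real.exp_neg]
    have h1 : Real.exp (-t / 2) * Real.exp t = Real.exp (t / 2) := by
      rw [← Real.exp_add]; congr 1; ring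
    rw [← mul_assoc, h1]
  · intro H R hR
    have h := H (Real.log R)
    rw [Real.exp_log hR, Real.exp_neg, Real.exp_log hR] at h
    have h2 : Real.exp (Real.log R / 2) = Real.exp (-Real.log R / 2) * R := by
      rw [show Real.log R / 2 = -Real.log R / 2 + Real.log R by ring, Real.exp_add, Real.exp_log hR]
    rw [h2, mul_assoc] at h
    exact mul_left_cancel₀ (Real.exp_pos _).ne' h

/-- With a parity-exact weight that is POSITIVE at the datum, the residual vanishes iff twisted balance holds: the limit
content of the reweighted odd statistic is `a b′ = a′ b` for EVERY such weight — the same as for the filed `1 + e^{−F}`.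
[folklore] -/
theorem parityExact_residual_eq_zero_iff (m : ℝ → ℝ) (hm : ∀ R : ℝ, 0 < R → m R = R * m R⁻¹)
    (a a' : ℝ) {b b' : ℝ} (hb : 0 < b) (hb' : 0 < b') (hpos : 0 < m (b' / b)) :
    a * m (b' / b) - a' * m (b / b') = 0 ↔ a * b' = a' * b := by
  rw [parityExact_residual m hm a a' hb hb', div_eq_zero_iff, mul_eq_zero, sub_eq_zero]
  constructor
  · rintro ((h | h) | h)
    · exact absurd h hpos.ne'
    · exact h
    · exact absurd h hb'.ne'
  · exact fun h => Or.inl (Or.inr h)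

/-! ## Members of the family -/

/-- The filed weight `1 + R` (`1 + e^{−F}`) is parity-exact (and unbounded). [folklore] -/
theorem parityExact_one_add : ∀ R : ℝ, 0 < R → (1 + R) = R * (1 + R⁻¹) := by
  intro R hR
  field_simp
  ring

/-- The Metropolis weight `min 1 R` (`min 1 (e^{−F})`, card metropolis-min-weight, repair C′₃) is parity-exact.
[folklore] -/
theorem parityExact_min : ∀ R : ℝ, 0 < R → min 1 R = R * min 1 R⁻¹ := by
  intro R hR
  rcases le_total 1 R with h | h
  · have hinv : R⁻¹ ≤ 1 := inv_le_one_of_one_le₀ h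
    rw [min_eq_left h, min_eq_right hinv, mul_inv_cancel₀ hR.ne']
  · have hinv : 1 ≤ R⁻¹ := (one_le_inv₀ hR).2 h
    rw [min_eq_right h, min_eq_left hinv, mul_one]

/-- The Barker / Fermi weight `R/(1+R)` (`(1 + e^{F})⁻¹`, smooth) is parity-exact. [folklore] -/
theorem parityExact_barker : ∀ R : ℝ, 0 < R → R / (1 + R) = R * (R⁻¹ / (1 + R⁻¹)) := by
  intro R hR
  field_simp
  ring

/-- **The even-cutoff family** (Disproof §7, C″): multiplying a parity-exact weight by any inversion-symmetric factor
`ζ R = ζ R⁻¹` (an even function of `F`, e.g. `max 0 (min 1 (L + 1 − |log R|))`) keeps it parity-exact. [folklore] -/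
theorem parityExact_mul_symm (m ζ : ℝ → ℝ) (hm : ∀ R : ℝ, 0 < R → m R = R * m R⁻¹)
    (hζ : ∀ R : ℝ, 0 < R → ζ R = ζ R⁻¹) :
    ∀ R : ℝ, 0 < R → m R * ζ R = R * (m R⁻¹ * ζ R⁻¹) := by
  intro R hR
  rw [← hζ R hR, hm R hR]
  ring

/-- Closed form of the Metropolis residual: `a·min(1, b′/b) − a′·min(1, b/b′) = (a b′ − a′ b)/max(b, b′)`. [folklore] -/
theorem metropolis_residual (a a' : ℝ) {b b' : ℝ} (hb : 0 < b) (hb' : 0 < b') :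
    a * min 1 (b' / b) - a' * min 1 (b / b') = (a * b' - a' * b) / max b b' := by
  rcases le_total b b' with h | h
  · have h1 : 1 ≤ b' / b := (one_le_div hb).2 h
    have h2 : b / b' ≤ 1 := (div_le_one hb').2 h
    rw [min_eq_left h1, min_eq_right h2, max_eq_right h]
    field_simp
  · have h1 : b' / b ≤ 1 := (div_le_one hb).2 h
    have h2 : 1 ≤ b / b' := (one_le_div hb').2 h
    rw [min_eq_right h1, min_eq_left h2, max_eq_left h]
    field_simp

/-- Closed form of the Barker residual: `a·b′/(b+b′) − a′·b/(b+b′) = (a b′ − a′ b)/(b + b′)`. [folklore] -/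
theorem barker_residual (a a' : ℝ) {b b' : ℝ} (hb : 0 < b) (hb' : 0 < b') :
    a * ((b' / b) / (1 + b' / b)) - a' * ((b / b') / (1 + b / b')) = (a * b' - a' * b) / (b + b') := by
  have hbb : 0 < b + b' := add_pos hb hb'
  field_simp
  ring

/-! ## Non-members and the order structure -/

/-- **Plain truncation is not parity-exact** (the language of this file for `truncation_breaks_parity`): `min (1+R) 2`
violates the functional equation at `R = 4` (`2 ≠ 4 · min (5/4) 2 = 5`). [folklore] -/
theorem not_parityExact_trunc : ¬ ∀ R : ℝ, 0 < R → min (1 + R) 2 = R * min (1 + R⁻¹) 2 := by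
  intro H
  have h := H 4 (by norm_num)
  norm_num [min_eq_right, min_eq_left] at h

/-- **Metropolis is the maximal sub-unit parity-exact weight.**  If `m` is parity-exact and `m ≤ 1` on `R > 0`, then
`m R ≤ min 1 R` for every `R > 0`.  (So `min 1 (e^{−F})` is the pointwise largest — statistically least wasteful — bounded
repair with the filed crux's exact limit content; every other one, e.g. Barker, lies below it.) [folklore] -/
theorem le_min_of_parityExact_le_one (m : ℝ → ℝ) (hm : ∀ R : ℝ, 0 < R → m R = R * m R⁻¹)
    (hle : ∀ R : ℝ, 0 < R → m R ≤ 1) : ∀ R : ℝ, 0 < R → m R ≤ min 1 R := by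
  intro R hR
  refine le_min (hle R hR) ?_
  rw [hm R hR]
  calc R * m R⁻¹ ≤ R * 1 := mul_le_mul_of_nonneg_left (hle R⁻¹ (inv_pos.2 hR)) hR.le
    _ = R := mul_one R

/-- **No uniqueness.**  There are two DIFFERENT parity-exact weights valued in `[0, 1]` on `R > 0` (Metropolis `min 1 R` and
Barker `R/(1+R)`, which differ at `R = 1`): the claim "the Metropolis weight is the unique bounded parity-exact twist" (title
of card metropolis-min-weight) is false as stated — the sub-unit parity-exact weights are exactly `√R·k(log R)` with `k` even
and `k t ≤ e^{−|t|/2}`, an infinite-dimensional family whose pointwise maximum is Metropolis. [folklore] -/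
theorem not_unique_subunit_parityExact :
    ∃ m₁ m₂ : ℝ → ℝ, (∀ R : ℝ, 0 < R → m₁ R = R * m₁ R⁻¹) ∧ (∀ R : ℝ, 0 < R → m₂ R = R * m₂ R⁻¹) ∧
      (∀ R : ℝ, 0 < R → 0 ≤ m₁ R ∧ m₁ R ≤ 1) ∧ (∀ R : ℝ, 0 < R → 0 ≤ m₂ R ∧ m₂ R ≤ 1) ∧ m₁ ≠ m₂ := by
  refine ⟨fun R => min 1 R, fun R => R / (1 + R), parityExact_min, parityExact_barker, ?_, ?_, ?_⟩
  · intro R hR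
    exact ⟨le_min zero_le_one hR.le, min_le_left _ _⟩
  · intro R hR
    have h1 : 0 < 1 + R := by linarith
    refine ⟨div_nonneg hR.le h1.le, ?_⟩
    rw [div_le_one h1]
    linarith
  · intro heq
    have h := congrFun heq 1
    norm_num at h

end OddContactSymmetryNegative

end Summit.AtomisticToContinuum.HydrodynamicLimit.Theorems
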